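import Summits.PneNP.PneNP.Theorems.BruckRyserSosSosBlindPlanesSpectral
import Summits.PneNP.PneNP.Theorems.BruckRyserSosSosBlindPlanesGenuine
import Summits.PneNP.PneNP.Theorems.BruckRyserSosSosBlindPlanesFormula

/-!
# PneNP / BruckRyserSos — the transfer: primes are feasible, hence all large orders are

Route `PneNP/BruckRyserSos`, crux stmt-PneNP-16761 (`SosBlindPlanes`), ninth file.

The bridge between the real constraints `GoodPt d x μ` of file `…Formula` and linear algebra on
the board of size `v = V(n) = n² + n + 1`:

* `traceVal_eq_trace` — the template-sum expression `T_{k+1}(n, μ)` IS `tr (M^{k+1})` for the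
  moment matrix `M` of the table (closed walks `…Spectral.trace_pow_succ` + the template-sum
  formula `…TemplateSum.sum_eq_templateSum`), and `hankelVal_eq_trace` — the Hankel form is
  `tr (M q(M) q(M))`;
* `momMatrix_posSemidef_of_goodPt` — hence Hankel positivity gives `M ⪰ 0`
  (`…Spectral.momMatrix_posSemidef_of_trace_nonneg`);
* `goodPt_genTable` — at a prime order the genuine table of `PG(2,p)` satisfies all constraints;
* `eventually_mem_feasSet` — so the semialgebraic set `F_d` contains all primes beyond `n₀(d)`,
  hence every sufficiently large real (`…Formula.eventually_mem_of_primes`): **for all large `n`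
  some table satisfies `GoodPt d n μ`** (`exists_goodPt_of_large`).

References: Bochnak–Coste–Roy (1998) Thm. 2.2.1; folklore.
-/

set_option linter.dupNamespace false -- `Summit.PneNP.PneNP.…`: summit = sub-problem name (D-0017 single-conjunct layout)

noncomputable section

namespace Summit.PneNP.PneNP.Theorems.SosBlindPlanes

open Finset Function Matrix Polynomial
open Literature.ModelTheory.ExponentialFields

variable {d v : ℕ}

/-! ### The template-sum expression is the trace -/

/-- `C(v, a) = (descending Pochhammer at `v`) / a!` over `ℝ`. [folklore] -/
theorem cast_choose_eq_descPochhammer (v a : ℕ) :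
    (v.choose a : ℝ) = (descPochhammer ℝ a).eval (v : ℝ) * (a.factorial : ℝ)⁻¹ := by
  rw [descPochhammer_eval_eq_descFactorial ℝ v a, Nat.descFactorial_eq_factorial_mul_choose]
  have : (a.factorial : ℝ) ≠ 0 := by positivity
  push_cast
  field_simp

/-- The real weight at `V(x) = v` is the template-sum weight. [folklore] -/
theorem weightR_eq_tsWeight {x : ℝ} (hx : Vr x = v) (a b : ℕ) :
    weightR d x a b = tsWeight v (Nsos d) a b := by
  simp only [weightR, chooseR, tsWeight, hx, cast_choose_eq_descPochhammer, div_eq_mul_inv]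

/-- The walk value of a template tuple is the walk weight of its embedding in the moment matrix.
[folklore] -/
theorem walkWeight_embT {μ : Tmpl d → ℝ} (hμ : TabInv μ) (hNv : Nsos d ≤ v) {k : ℕ}
    (ω : Fin (k + 2) → Idx (Nsos d) (d / 2)) :
    walkWeight (momMatrix v (d + 1) (d / 2) μ) (embT hNv ω) = walkVal d μ k ω := by
  simp only [walkWeight, walkVal]
  refine prod_congr rfl fun i _ => ?_
  rw [embT_apply, embT_apply, momMatrix_apply, embIdx_val, embIdx_val, ← rel_union,
    tmom_rel hμ (Nat.succ_pos d) (emb_injective hNv).injOn (emb_injective hNv).injOn,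
    tmom_of_card_le, shrink]
  refine (card_union_le _ _).trans ?_
  have h1 := (ω i.castSucc).2
  have h2 := (ω i.succ).2
  omega

/-- **`T_{k+1}(x, μ) = tr (M^{k+1})`** for the moment matrix `M` of an invariant table on the
board of size `v = V(x) ≥ Nsos d`, for `k + 2 ≤ 2 K₁`. [folklore] -/
theorem traceVal_eq_trace {μ : Tmpl d → ℝ} (hμ : TabInv μ) (hNv : Nsos d ≤ v) {x : ℝ}
    (hx : Vr x = v) {k : ℕ} (hk : k + 2 ≤ 2 * K₁ d) :
    traceVal d k x μ = ((momMatrix v (d + 1) (d / 2) μ) ^ (k + 1)).trace := by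
  set M := momMatrix v (d + 1) (d / 2) μ with hM
  rw [trace_pow_succ]
  have hinv : ∀ (σ τ : Equiv.Perm (Fin v)) (z : Fin (k + 2) → Idx v (d / 2)),
      (fun z : Fin (k + 2) → Idx v (d / 2) =>
        if z 0 = z (Fin.last (k + 1)) then walkWeight M z else 0) (fun i => act σ τ (z i)) =
      (if z 0 = z (Fin.last (k + 1)) then walkWeight M z else 0) := by
    intro σ τ z
    simp only [(act_injective σ τ).eq_iff]
    split_ifs
    · simp only [walkWeight, hM, momMatrix_act hμ (Nat.succ_pos d)]
    · rfl
  rw [sum_eq_templateSum (Nsos_pos d) hNv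
    (by rw [Nsos]; exact (Nat.mul_le_mul_right _ hk).trans (Nat.le_succ _)) _ hinv]
  rw [traceVal]
  refine sum_congr rfl fun ω _ => ?_
  rw [weightR_eq_tsWeight hx]
  congr 1
  have h0 : embT hNv ω 0 = embT hNv ω (Fin.last (k + 1)) ↔ ω 0 = ω (Fin.last (k + 1)) := by
    simp only [embT_apply, (embIdx_injective (Nsos_pos d) hNv).eq_iff]
  simp only [h0]
  split_ifs
  · exact (walkWeight_embT hμ hNv ω).symm
  · rfl

/-- The polynomial with coefficient vector `c`. [folklore] -/
def qOf (d : ℕ) (c : Fin (K₁ d) → ℝ) : ℝ[X] :=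
  ∑ a : Fin (K₁ d), monomial (a : ℕ) (c a)

/-- `tr (M q_c(M) q_c(M)) = Σ_{a,b} c_a c_b tr (M^{a+b+1})`. [folklore] -/
theorem trace_mul_aeval_qOf {ι : Type*} [Fintype ι] [DecidableEq ι] (M : Matrix ι ι ℝ)
    (c : Fin (K₁ d) → ℝ) :
    (M * aeval M (qOf d c) * aeval M (qOf d c)).trace =
      ∑ a : Fin (K₁ d), ∑ b : Fin (K₁ d), c a * c b * (M ^ ((a : ℕ) + b + 1)).trace := by
  have hq : aeval M (qOf d c) = ∑ a : Fin (K₁ d), c a • M ^ (a : ℕ) := by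
    simp only [qOf, map_sum, aeval_monomial, Algebra.algebraMap_eq_smul_one, smul_mul_assoc, one_mul]
  rw [hq, Finset.mul_sum, Matrix.trace_sum]
  conv_rhs => rw [Finset.sum_comm]
  refine sum_congr rfl fun b _ => ?_
  rw [Finset.mul_sum, Finset.sum_mul, Matrix.trace_sum]
  refine sum_congr rfl fun a _ => ?_
  simp only [Matrix.mul_smul, Matrix.smul_mul, smul_smul, Matrix.trace_smul, smul_eq_mul]
  have : M * M ^ (a : ℕ) * M ^ (b : ℕ) = M ^ ((a : ℕ) + b + 1) := by
    rw [← pow_succ', ← pow_add]; congr 1; ring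
  rw [this]; ring

/-- **The Hankel form is `tr (M q_c(M) q_c(M))`.** [folklore] -/
theorem hankelVal_eq_trace {μ : Tmpl d → ℝ} (hμ : TabInv μ) (hNv : Nsos d ≤ v) {x : ℝ}
    (hx : Vr x = v) (c : Fin (K₁ d) → ℝ) :
    hankelVal d x μ c = (momMatrix v (d + 1) (d / 2) μ * aeval (momMatrix v (d + 1) (d / 2) μ)
      (qOf d c) * aeval (momMatrix v (d + 1) (d / 2) μ) (qOf d c)).trace := by
  rw [trace_mul_aeval_qOf, hankelVal]
  refine sum_congr rfl fun a _ => sum_congr rfl fun b _ => ?_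
  rw [traceVal_eq_trace hμ hNv hx (by have := a.2; have := b.2; omega)]

/-- Every polynomial of degree `< K₁` is some `q_c`. [folklore] -/
theorem exists_qOf_eq (q : ℝ[X]) (hq : q.natDegree < K₁ d) : ∃ c : Fin (K₁ d) → ℝ, qOf d c = q := by
  refine ⟨fun a => q.coeff a, ?_⟩
  rw [qOf]
  conv_rhs => rw [q.as_sum_range' (K₁ d) hq]
  rw [← Fin.sum_univ_eq_sum_range]

/-- **Hankel positivity gives a positive semidefinite moment matrix** (board size
`v = V(x) ≥ Nsos d`). [folklore] -/
theorem momMatrix_posSemidef_of_goodPt {μ : Tmpl d → ℝ} {x : ℝ} (hgood : GoodPt d x μ)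
    (hNv : Nsos d ≤ v) (hDv : d + 1 ≤ v) (hx : Vr x = v) :
    (momMatrix v (d + 1) (d / 2) μ).PosSemidef := by
  refine momMatrix_posSemidef_of_trace_nonneg hgood.1 (Nat.succ_pos d) hDv
    (by omega) fun q hq => ?_
  obtain ⟨c, rfl⟩ := exists_qOf_eq q hq
  rw [← hankelVal_eq_trace hgood.1 hNv hx c]
  exact hgood.2.2.2.2.2.2 c

/-! ### Primes are feasible -/

/-- `V(n) = n² + n + 1` for a natural number `n`. [folklore] -/
theorem Vr_natCast (n : ℕ) : Vr (n : ℝ) = ((n ^ 2 + n + 1 : ℕ) : ℝ) := by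
  simp [Vr]

/-- **At a prime order the genuine table satisfies all constraints.** [folklore] -/
theorem goodPt_genTable {n : ℕ} {Inc : Finset (Fin (n ^ 2 + n + 1) × Fin (n ^ 2 + n + 1))}
    (hInc : IsPlaneInc n Inc) (hDv : d + 1 ≤ n ^ 2 + n + 1) (hNv : Nsos d ≤ n ^ 2 + n + 1) :
    GoodPt d (n : ℝ) (genTable hDv Inc) := by
  have hV := Vr_natCast n
  have hr1 : rcoef 1 (n : ℝ) = (n : ℝ) + 1 := by simp [rcoef]
  have hr2 : rcoef 2 (n : ℝ) = 1 := by simp [rcoef]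
  refine ⟨tabInv_genTable hDv Inc, genTable_empty hDv Inc, ?_, ?_, ?_, ?_, ?_⟩
  · rw [hV, hr1]; exact rowIdentity_dens hInc hDv _ (Or.inl ⟨rfl, rfl⟩)
  · rw [hV, hr2]; exact rowIdentity_dens hInc hDv _ (Or.inr ⟨rfl, rfl⟩)
  · rw [hV, hr1]; exact rowIdentity_dens_swapC hInc hDv _ (Or.inl ⟨rfl, rfl⟩)
  · rw [hV, hr2]; exact rowIdentity_dens_swapC hInc hDv _ (Or.inr ⟨rfl, rfl⟩)
  · intro c
    rw [hankelVal_eq_trace (tabInv_genTable hDv Inc) hNv hV c]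
    exact trace_mul_aeval_sq_nonneg
      (momMatrix_genTable_posSemidef (Nat.succ_pos d) hDv (by omega) Inc) _

/-- **Every sufficiently large prime is feasible.** [folklore] -/
theorem prime_mem_feasSet {p : ℕ} (hp : p.Prime) (hlarge : Nsos d + (d + 1) ≤ p) :
    (fun _ : Unit => (p : ℝ)) ∈ feasSet d := by
  rw [mem_feasSet_iff]
  obtain ⟨Inc, hInc⟩ := exists_isPlaneInc_prime p hp
  have hv : p ≤ p ^ 2 + p + 1 := by nlinarith
  exact ⟨_, goodPt_genTable hInc (by omega) (by omega)⟩

/-- **Transfer.** `F_d` contains every sufficiently large real. [BCR 1998, Thm. 2.2.1 +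
Prop. 2.1.7] [folklore] -/
theorem eventually_mem_feasSet (d : ℕ) : ∃ N : ℝ, ∀ t, N ≤ t → (fun _ : Unit => t) ∈ feasSet d := by
  refine eventually_mem_of_primes (isSemialgebraic_feasSet d) fun n₀ => ?_
  obtain ⟨p, hp₀, hp⟩ := Nat.exists_infinite_primes (n₀ + (Nsos d + (d + 1)))
  exact ⟨p, by omega, hp, prime_mem_feasSet hp (by omega)⟩

/-- **For every sufficiently large order some table satisfies all constraints.** [folklore] -/
theorem exists_goodPt_of_large (d : ℕ) : ∃ N₀ : ℕ, ∀ n : ℕ, N₀ ≤ n →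
    ∃ μ : Tmpl d → ℝ, GoodPt d (n : ℝ) μ := by
  obtain ⟨N, hN⟩ := eventually_mem_feasSet d
  refine ⟨⌈N⌉₊, fun n hn => ?_⟩
  have h := hN (n : ℝ) ((Nat.le_ceil N).trans (by exact_mod_cast hn))
  exact (mem_feasSet_iff _).1 h

end Summit.PneNP.PneNP.Theorems.SosBlindPlanes
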